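import Mathlib

/-!
# `BalabanImbrieJaffe1984to88.BIJ85Sect4Statements` — T. Bałaban, J. Imbrie, A. Jaffe, *Renormalization of the Higgs model:
minimizers, propagators and the stability of mean field theory*, Commun. Math. Phys. **97** (1985) 299–329
[BalabanImbrieJaffe1985]: Sects. 4–5 — the axial gauge minimizer (4.1.3)–(4.1.5), the quadratic form σ_k (4.2.1)–(4.2.7), the
curl action Δ_k and the unit-lattice propagator C^{(k)} (4.3.1)–(4.3.5), the propagator 𝒟_k (4.4.4), the background field (4.5.4),
the scalar-field objects (4.6.2)–(4.6.4), and **Propositions 5.1.1, 5.2.1 (printed "6.2"), 5.2.2**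

statement-level skeleton of published theorems with citation tags; proofs where landed; nothing here is a claim about the Yang–Mills mass gap

PDF held: `paper:balaban1985-cmp97-bij-higgs-minimizers` (journal page = PDF page + 298).  Renders read as images: PDF pp. 11–18
(journal 309–316): `run/shared/lean/pub/pub-balaban/t4/b2b-balaban-t4-lit2/renders/bij1985/…-p011,p012,p013,p018-x2.png`,
`run/shared/lean/pub/lit-balaban/lit-balaban-r15/pages/…-p014,p016-x2.png`, full-resolution crops of p. 313.

CITATION HEADER (lean-in-tree rule).  Part of the lit-balaban TYPED SKELETON (HOME `run/shared/lean/pub/lit-balaban/`; rows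
C1.Eq4.1.3 … C1.Prop5.2.2 of `HOME/lit-balaban-r15/ROWS-C1-part2.md`).  WHAT IS REPRODUCED, and how.  The objects of Sect. 4 are
DEFINED in print by Gaussian functional integrals with δ-function constraints ((4.1.1), (4.1.3), (4.2.1), (4.3.3), (4.4.2)); they are
carried here by an abstract carrier `GaugeRG` (one scale k: unit-lattice bond fields B, η-lattice bond fields A, plaquette fields,
the averaging Q_k, the minimizers H_{k,Ax}, H_k, the form σ_k with its norm, the curl ∂) whose Prop-valued definitions state the
printed CLAIMS about them: **(4.1.5)** Q_kH_{k,Ax}B = B, **(4.2.3)**/(7.1.1) 0 < c ≤ σ_k, **(4.2.7)**, **(4.3.1)** (Δ_k as a real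
definition from σ_k and ∂), **(4.3.4)–(4.3.5)** (bounds on C^{(k)}, "established by Balaban [6II]" = [Balaban1984PropagatorsII]
(2.157) — a DEPGRAPH edge), **Prop. 5.1.1** (5.1.1)/(5.1.4) (λ as a real definition from the carrier's contour functionals) and
**Prop. 5.2.2** (5.2.6)–(5.2.7).  PROVED (pure operator algebra, in an arbitrary ring of operators): **(4.2.2)** from Q^e_kQ^{e*}_k =
η^{−2} (`eq422`), **(4.4.4)**/(5.2.2) as definitions by finite sums and **Prop. 5.2.1** "(5.2.1) and (5.2.2) are equivalent"
(`prop521_iff`), (4.6.4) from (4.6.2) as stated shape.  Carrier clauses (F6): the functional integrals, the gauge conditions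
δ_{k,Ax}, 𝒢(∂*A), the lattice geometry, and the identification of the abstract operators with the printed ones are the
instance's.  NOTHING of the paper is asserted beyond the kernel-checked algebra.  Unit `lit-balaban-r15` (second reader of C1,
Sects. 4–7 per SKELETON.md §1 Rule 3).
-/

namespace Literature.MathematicalPhysics.QuantumFieldTheory.BalabanImbrieJaffe1984to88.BIJ85Sect4Statements

open Finset

/-! ## Pure operator algebra: (4.2.2), (4.4.4), Proposition 5.2.1 -/

/-- **(4.2.2)** p. 310 [PDF 12], verbatim: *"Clearly σ_k is related to the propagator G_{k,Ax} of Sect. 4.1. Comparing (4.2.1) with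
(4.1.1) we find σ_k = Q^e_k(I − ∂G_{k,Ax}∂*)Q^{e*}_k = η^{−2}I − Q^e_k∂G_{k,Ax}∂*Q^{e*}_k. (4.2.2) Here we have used Q^e_kQ^{e*}_k = η^{−2},
see (2.24)."* — the second equality PROVED as operator algebra in any ring, from the printed input Q^e_kQ^{e*}_k = η^{−2}I (the
first equality is the functional-integral computation of the instance). [cite: BalabanImbrieJaffe1985, (4.2.2) p.310] -/
theorem eq422 {R : Type*} [Ring R] (Qe Qes D G Ds c : R) (hQ : Qe * Qes = c) :
    Qe * (1 - D * G * Ds) * Qes = c - Qe * D * G * Ds * Qes := by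
  rw [mul_sub, mul_one, sub_mul, hQ]
  simp only [mul_assoc]

/-- **(4.4.4)** p. 312 [PDF 14], verbatim: *"Rather, we define a propagator 𝒟_k in terms of minimizers H_j and the covariance operators
C^{(j)} of Sect. 4.3. Let 𝒟_k ≡ Σ_{j=0}^{k−1} H_jC^{(j)}H_j^*. (4.4.4)"* — as a definition in a ring of operators, from the sequences
j ↦ H_j, C^{(j)}, H_j^*. [cite: BalabanImbrieJaffe1985, (4.4.4) p.312] -/
def curlyD {R : Type*} [Ring R] (H C Hs : ℕ → R) (k : ℕ) : R :=
  ∑ j ∈ range k, H j * C j * Hs j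

/-- **Proposition 5.2.1** (printed as "Proposition 6.2", p. 316 [PDF 18]; numbering slip — it sits in Sect. 5.2 between
Prop. 5.1.1 and Prop. 5.2.2), verbatim: *"The G_{k,Ax} satisfy the recursion relation G_{k,Ax} = H_{k−1,Ax}C^{(k−1)}H*_{k−1,Ax} +
G_{k−1,Ax}, (5.2.1) with the solution: G_{k,Ax} = Σ_{j=0}^{k−1} H_{j,Ax}C^{(j)}H*_{j,Ax}. (5.2.2) Proof. Clearly (5.2.1) and (5.2.2) are
equivalent."* — the asserted EQUIVALENCE, PROVED for a sequence G in a ring with G_0 = 0 (the empty sum; in print G_{0,Ax} is not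
defined and k ≥ 1).  The printed derivation of (5.2.1) from (4.1.1) ((5.2.3)–(5.2.5)) is the instance's.
[cite: BalabanImbrieJaffe1985, Prop. 5.2.1 (5.2.1)–(5.2.2) p.316] -/
theorem prop521_iff {R : Type*} [Ring R] (G Hax C Haxs : ℕ → R) (h0 : G 0 = 0) :
    (∀ k, G (k + 1) = Hax k * C k * Haxs k + G k) ↔ ∀ k, G k = curlyD Hax C Haxs k := by
  constructor
  · intro h k
    induction k with
    | zero => simp [curlyD, h0]
    | succ k ih => rw [h k, ih, curlyD, curlyD, Finset.sum_range_succ, add_comm]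
  · intro h k
    rw [h (k + 1), h k, curlyD, curlyD, Finset.sum_range_succ, add_comm]

/-! ## The carrier of Sects. 4–5 (one scale k) -/

/-- Abstract carrier of Sects. 4–5 at one scale k (η = L^{−k}): the unit-lattice bond fields B (`FieldU`, with Lie-algebra gauge
functions `GaugeU` and their gradient), the η-lattice bond fields A (`FieldEta`, gauge functions `GaugeEta`, gradient `gradEta` =
∂λ), unit-lattice plaquette fields f (`PlaqU`) with the inner product ⟨·,·⟩ and the curl ∂B, the averaging Q_k, the axial gauge
minimizer H_{k,Ax} ((4.1.3), *"which maps B into such a minimizing configuration for axial gauge"*), the Landau gauge minimizer H_k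
(4.4.2), the quadratic form σ_k as a symmetric bilinear form on plaquette fields ((4.2.1)), the propagator C^{(k)} as a kernel on
pairs of unit-lattice bonds with its operator norm and the distance |x − y|, and — for Prop. 5.1.1 — the printed contour
functionals of Q_jH_kB: `contourTerm B j x` = (Q_jH_kB)(Γ_{x_{j+1},x_j}) and `blockTerm B j x` = Σ_{x′∈B(x_{j+1})}(L^{−d}Q_jH_kB)
(Γ_{x_{j+1},x′}) for the sequence x = x₀, …, x_k of (5.1.2)–(5.1.3).  Carrier clauses (F6): every one of these objects is defined
in print by a formula this structure does not reproduce; their identification is the instance's.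
[cite: BalabanImbrieJaffe1985, (4.1.3)–(4.1.5) p.310] -/
structure GaugeRG where
  /-- the scale index k -/
  k : ℕ
  /-- block size L -/
  L : ℕ
  /-- dimension d -/
  d : ℕ
  /-- unit-lattice bond fields B -/
  FieldU : Type
  /-- η-lattice bond fields A -/
  FieldEta : Type
  [grpEta : AddCommGroup FieldEta]
  /-- unit-lattice points -/
  SiteU : Type
  /-- η-lattice points -/
  SiteEta : Type
  /-- gauge functions λ on the η-lattice -/
  GaugeEta : Type
  /-- ∂λ -/
  gradEta : GaugeEta → FieldEta
  /-- building a gauge function from its values -/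
  mkGauge : (SiteEta → ℝ) → GaugeEta
  /-- unit-lattice plaquette fields f -/
  PlaqU : Type
  [grpPlaq : AddCommGroup PlaqU]
  [modPlaq : Module ℝ PlaqU]
  /-- ⟨f, g⟩ on plaquette fields -/
  innerP : PlaqU → PlaqU → ℝ
  /-- ∂B, the plaquette field (curl) of a unit-lattice bond field -/
  curl : FieldU → PlaqU
  /-- Q_k A -/
  Qk : FieldEta → FieldU
  /-- H_{k,Ax} B, (4.1.3) -/
  Hax : FieldU → FieldEta
  /-- H_k B, the Landau gauge minimizer (4.4.2) -/
  H : FieldU → FieldEta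
  /-- (f, g) ↦ ⟨f, σ_k g⟩, the quadratic form (4.2.1) -/
  sigma : PlaqU → PlaqU → ℝ
  /-- unit-lattice bonds (arguments of the kernel C^{(k)}(x, y)) -/
  BondU : Type
  /-- |x − y| -/
  distU : BondU → BondU → ℝ
  /-- the kernel C^{(k)}(x, y) of (4.3.3) -/
  Ck : BondU → BondU → ℝ
  /-- ‖C^{(k)}‖ -/
  normCk : ℝ
  /-- (Q_jH_kB)(Γ_{x_{j+1},x_j}) for the point sequence of x, (5.1.2)–(5.1.3) -/
  contourTerm : FieldU → ℕ → SiteEta → ℝ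
  /-- Σ_{x′∈B(x_{j+1})} (L^{−d}Q_jH_kB)(Γ_{x_{j+1},x′}) -/
  blockTerm : FieldU → ℕ → SiteEta → ℝ

namespace GaugeRG

variable (S : GaugeRG)

/-- plumbing (API for the carrier of Sects. 4–5): the additive group of η-lattice bond fields. [cite: BalabanImbrieJaffe1985, (4.1.3)–(4.1.5) p.310] -/
instance instGrpEta : AddCommGroup S.FieldEta := S.grpEta

/-- plumbing (API for the carrier of Sects. 4–5): the additive group of plaquette fields. [cite: BalabanImbrieJaffe1985, (4.2.1) p.310] -/
instance instGrpPlaq : AddCommGroup S.PlaqU := S.grpPlaq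

/-- plumbing (API for the carrier of Sects. 4–5): the real vector space of plaquette fields. [cite: BalabanImbrieJaffe1985, (4.2.1) p.310] -/
instance instModPlaq : Module ℝ S.PlaqU := S.modPlaq

/-- **(4.1.5)** p. 310 [PDF 12], verbatim: *"H_{k,Ax} which maps B into such a minimizing configuration for axial gauge, and we call
H_{k,Ax} the axial gauge minimizer. Explicitly, H_{k,Ax}B = Z_{k,Ax}(B)^{−1}∫𝒟Aδ(Q_kA − B)δ_{k,Ax}(A)A exp(−½‖∂A‖²), (4.1.3) where
Z_{k,Ax}(B) = ∫𝒟Aδ(Q_kA − B)δ_{k,Ax}(A)exp(−½‖∂A‖²). (4.1.4) Note that by definition Q_kH_{k,Ax}B = B. (4.1.5)"*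
[cite: BalabanImbrieJaffe1985, (4.1.5) p.310] -/
def Eq415 (S₀ : GaugeRG) : Prop :=
  ∀ B : S₀.FieldU, S₀.Qk (S₀.Hax B) = B

/-- ‖f‖² = ⟨f, f⟩ on plaquette fields. [cite: BalabanImbrieJaffe1985, (4.2.7) p.310] -/
def normSqP (f : S.PlaqU) : ℝ := S.innerP f f

/-- **(4.2.3)** p. 310 [PDF 12] at a given constant c, verbatim: *"Using that representation we also establish a uniform, positive
lower bound 0 < c ≤ σ_k. (4.2.3)"* — read as a quadratic-form inequality c‖f‖² ≤ ⟨f, σ_kf⟩ for all plaquette fields f (the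
uniformity in k is `…BIJ85Sect7Statements.Thm711`). [cite: BalabanImbrieJaffe1985, (4.2.3) p.310] -/
def Ineq423 (c : ℝ) : Prop :=
  0 < c ∧ ∀ f : S.PlaqU, c * S.normSqP f ≤ S.sigma f f

/-- **(4.3.1)** p. 311 [PDF 13], verbatim: *"The quadratic form σ_k simplifies on curls, namely for fields f of the form f = ∂B. In
particular ⟨∂B, σ_k∂B⟩ = ⟨B, Δ_kB⟩, (4.3.1) which defines an action Δ_k."* — Δ_k as the bilinear form so DEFINED.
[cite: BalabanImbrieJaffe1985, (4.3.1) p.311] -/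
def DeltaForm (B B' : S.FieldU) : ℝ :=
  S.sigma (S.curl B) (S.curl B')

/-- **(4.3.4)** p. 311 [PDF 13] at a given constant, verbatim: *"The actions Δ_k and propagators C^{(k)} were studied by Balaban [6II]
who established that C^{(k)} is well defined and is bounded in norm ‖C^{(k)}‖ ≤ c (4.3.4) uniformly in k."* ([6II] =
[Balaban1984PropagatorsII]). [cite: BalabanImbrieJaffe1985, (4.3.4) p.311] -/
def Ineq434 (c : ℝ) : Prop :=
  S.normCk ≤ c

/-- **(4.3.5)** p. 311 [PDF 13] at given constants, verbatim: *"Furthermore C^{(k)} has a kernel which decays exponentially, uniformly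
in k. |C^{(k)}(x, y)| ≤ a exp(−b|x − y|). (4.3.5)"* [cite: BalabanImbrieJaffe1985, (4.3.5) p.311] -/
def Ineq435 (a b : ℝ) : Prop :=
  ∀ x y : S.BondU, |S.Ck x y| ≤ a * Real.exp (-(b * S.distU x y))

/-- **(5.1.4)** p. 314 [PDF 16]: the gauge function of Proposition 5.1.1, verbatim: *"λ(x) = −Σ_{j=0}^{k−1} L^{j−k}[(Q_jH_kB)
(Γ_{x_{j+1},x_j}) − Σ_{x′∈B(x_{j+1})} (L^{−d}Q_jH_kB)(Γ_{x_{j+1},x′})]. (5.1.4) Here we use (Q_jH_kB)(Γ) = Σ_{b∈Γ}(Q_jH_kB)(b), with no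
factor of the lattice spacing for Γ."* — a real definition from the carrier's two contour functionals (the point sequence
x = x₀, x₁, …, x_k with x_j ∈ B(x_{j+1}), (5.1.2)–(5.1.3), is inside them). [cite: BalabanImbrieJaffe1985, (5.1.4) p.314] -/
noncomputable def lam514 (B : S.FieldU) (x : S.SiteEta) : ℝ :=
  -∑ j ∈ range S.k, (S.L : ℝ) ^ ((j : ℤ) - S.k) * (S.contourTerm B j x - S.blockTerm B j x)

/-- **Proposition 5.1.1** p. 313–314 [PDF 15–16], verbatim: p. 313 *"We claim that H_{k,Ax}B and H_kB differ by a gauge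
transformation, H_{k,Ax}B − H_kB = ∂λ. (5.1.1) We show that λ is an explicit, linear function of H_kB. In order to specify λ, we
choose a sequence of points x₀, …, x_k, where x = x₀, y = x_k, and where x ∈ B^j(x_j), x_j ∈ T^{(j)}_{L^jη}, (5.1.2) that is
x_j ∈ B(x_{j+1}). (5.1.3) The contour Γ_{x_j,x} runs from x to x₁ in B(x₁), from x₁ to x₂ in B(x₂), etc."*; p. 314 *"Proposition
5.1.1. The relation (5.1.1) holds with [(5.1.4)]."*  Printed proof: pp. 314–315 (Faddeev–Popov, (5.1.5)–(5.1.15)).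
[cite: BalabanImbrieJaffe1985, Prop. 5.1.1 p.314] -/
def Prop511 (S₀ : GaugeRG) : Prop :=
  ∀ B : S₀.FieldU, S₀.Hax B - S₀.H B = S₀.gradEta (S₀.mkGauge (S₀.lam514 B))

end GaugeRG

/-! ## Proposition 5.2.2 -/

/-- Abstract carrier for Proposition 5.2.2 p. 316 [PDF 18]: sources J (η-lattice bond fields), the composed operators G_{k,Ax}∂*,
𝒟_k∂* and H_jC^{(j)}H_j^*∂* (j < k) acting on them, the gradient ∂ of η-lattice gauge functions, and the gauge-function-valued maps
λ_j(·) of Proposition 5.1.1 "with k set equal to j", applied to an operator. [cite: BalabanImbrieJaffe1985, Prop. 5.2.2 p.316] -/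
structure Prop522Data where
  /-- scale -/
  k : ℕ
  /-- η-lattice bond fields / sources -/
  Field : Type
  [grp : AddCommGroup Field]
  /-- gauge functions -/
  Gauge : Type
  [grpG : AddCommGroup Gauge]
  /-- ∂ -/
  grad : Gauge →+ Field
  /-- J ↦ G_{k,Ax}∂*J -/
  GaxDs : Field → Field
  /-- J ↦ 𝒟_k∂*J -/
  DkDs : Field → Field
  /-- j ↦ (J ↦ H_jC^{(j)}H_j^*∂*J) -/
  HCHDs : ℕ → Field → Field
  /-- j ↦ λ_j(T): the gauge function of Prop. 5.1.1 (k := j) built from the operator T, as a function of the source -/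
  lamOp : ℕ → (Field → Field) → Field → Gauge

namespace Prop522Data

variable (P : Prop522Data)

/-- plumbing (API for the carrier of Prop. 5.2.2): the additive group of sources. [cite: BalabanImbrieJaffe1985, Prop. 5.2.2 p.316] -/
instance instGrp : AddCommGroup P.Field := P.grp

/-- plumbing (API for the carrier of Prop. 5.2.2): the additive group of gauge functions. [cite: BalabanImbrieJaffe1985, Prop. 5.2.2 p.316] -/
instance instGrpG : AddCommGroup P.Gauge := P.grpG

/-- **(5.2.7)** p. 316 [PDF 18], verbatim: *"Explicitly D = Σ_{j=0}^{k−1} λ_j(H_jC^{(j)}H_j^*∂*), (5.2.7) where λ_j is the function of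
Proposition 5.1.1 with k set equal to j."* [cite: BalabanImbrieJaffe1985, (5.2.7) p.316] -/
def D527 (J : P.Field) : P.Gauge :=
  ∑ j ∈ range P.k, P.lamOp j (P.HCHDs j) J

/-- **Proposition 5.2.2** p. 316 [PDF 18], verbatim: *"There is a gauge transformation D such that G_{k,Ax}∂* − 𝒟_k∂* = ∂D. (5.2.6)
Explicitly [(5.2.7)]. Here we write the operator identity, rather than the identity G_{k,Ax}∂*B = 𝒟_k∂*B + ∂DB for
configurations."*  Printed proof: p. 316–317 from (5.2.1), (5.2.8) H*_{j,Ax}∂* = H*_j∂*, and Prop. 5.1.1.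
[cite: BalabanImbrieJaffe1985, Prop. 5.2.2 (5.2.6) p.316] -/
def Prop522 (P₀ : Prop522Data) : Prop :=
  ∀ J : P₀.Field, P₀.GaxDs J - P₀.DkDs J = P₀.grad (P₀.D527 J)

end Prop522Data

/-! ## (4.5.4), (4.6.2)–(4.6.4): the background field and the scalar-field objects, as operator algebra -/

/-- **(4.6.2)–(4.6.4)** p. 313 [PDF 15], verbatim: *"Since no restrictions on φ occur in the Gaussian integral (4.6.1), we can also write
G_k(u_k) = [−Δ_{u_k} + a_kQ_k^*(u_k)Q_k(u_k)]^{−1}, (4.6.2) where −Δ_{u_k} = D*_{u_k}D_{u_k}. (4.6.3) The coefficients a_k are produced by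
iterating one-step renormalization transformations which use a constant a in the Gaussian. This yields a_k = a(1 − L^{−2})
(1 − L^{−2k})^{−1} in the k-step transformation [3]. The quadratic form which arises for the scalar field is ⟨ψ, Δ_k(u_k)ψ⟩, where ψ is
the unit lattice scalar field and where Δ_k(u_k) = a_kI − a_k²Q_k(u_k)G_k(u_k)Q_k^*(u_k). (4.6.4)"* — the printed coefficient a_k as a
real definition ([3] = [Balaban1983Higgs3]'s companion (Higgs)₂,₃ I; cf. `…Balaban1983to89.B1.aSeq`).
[cite: BalabanImbrieJaffe1985, (4.6.2)–(4.6.4) p.313] -/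
noncomputable def aK (a L : ℝ) (k : ℕ) : ℝ :=
  a * (1 - L ^ (-(2 : ℤ))) * (1 - L ^ (-(2 * (k : ℤ))))⁻¹

/-- kernel: a₁ = a (the one-step transformation uses the constant a). [cite: BalabanImbrieJaffe1985, (4.6.4) p.313] -/
theorem aK_one (a L : ℝ) (hL : 1 < L) : aK a L 1 = a := by
  unfold aK
  have h : (1 : ℝ) - L ^ (-(2 : ℤ)) ≠ 0 := by
    have hL0 : 0 < L := by linarith
    have : L ^ (-(2 : ℤ)) < 1 := by
      rw [zpow_neg, inv_lt_one_iff₀]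
      right
      have : (1 : ℝ) < L ^ (2 : ℤ) := by
        rw [zpow_two]; nlinarith
      exact this
    linarith
  simp only [Nat.cast_one, mul_one]
  rw [mul_assoc, mul_inv_cancel₀ h, mul_one]

/-- **(4.6.4)** as operator algebra: in a ring of operators, Δ_k(u) := a_k·1 − a_k²·QGQ* for given Q = Q_k(u_k), G = G_k(u_k),
Qs = Q_k^*(u_k). [cite: BalabanImbrieJaffe1985, (4.6.4) p.313] -/
def deltaScalar {R : Type*} [Ring R] [Algebra ℝ R] (ak : ℝ) (Q G Qs : R) : R :=
  algebraMap ℝ R ak - algebraMap ℝ R (ak ^ 2) * (Q * G * Qs)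

end Literature.MathematicalPhysics.QuantumFieldTheory.BalabanImbrieJaffe1984to88.BIJ85Sect4Statements
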